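import Literature.NumberTheory.Automorphic.OrbitalMeasureCanonical   -- ★ `compactCore`, `compactCore_eq_univ`
import Literature.NumberTheory.Rogawski1990.Ch12Sec5Defs             -- ★ `Ch12Sec5.weylOrder` (the `|Ω(T,G)|` of ★ `innerG` ∕ `innerH`)
import HarnessLib

/-!
# F0 · P3c · line LH6 «StCharTS» — CENSUS «1252 ∕ ELL-INNER» brick (E7) «MEASURES»: the measure ∕ index glue between the RUNG0 Cartan pins
# (`hKHO hHaarHO hprobHO`, `hcartO hHaarGO hcoreGO`) and the (E0)∕(A1′) letters (`tH`, `htH : tH T (compactCore ↥T) = 1`, `[N(T):T]`)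
# [Rogawski1990, §12.5 p. 182 «meas(Z∖T) = 1», p. 184; §3.6 p. 29 `|Ω(T,G)|`]

Cell `pub/hodgecm-mathlib`, crux H413 = `stmt-HodgeConjecture-24833` (lane `--kind proof --supports … --as helper`), route HCCMUnconditional; seat F0P2-p02 (g22);
brick (E7) of LH6-p03 (g7)'s CENSUS «1252 ∕ ELL-INNER» v1 (`F0/P3b/LH6-p03/g7/CENSUS-1252-ELL-INNER.v1.LH6p03g7.md` 06afd1d3), dealt 19:56:33Z («E7 mine» 19:56:43Z);
desk F0P3-plan (g18) 19:53:05Z: count-neutral helper, consumed by nothing in flight until ELL-INNER is chartered.  THEOREMS ONLY, sorry-free, no definition ∕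
instance ∕ notation ∕ named fact ∕ `Lines` import; GENERIC in a topological group `X` (the callers instantiate `X := Gqs L v` ∕ `X := H_v`).
HONEST LABEL: HC_CM is proved only modulo the 7 printed citations (2 remaining: hLiu418 = stmt-HodgeConjecture-24832, h413 = stmt-HodgeConjecture-24833) until rung 0
closes; `𝔇.Prop1252` stays a PRINTED consequent of `hBlock′` [Rogawski1990 §12.5 Prop. 12.5.2] until a ★ rider removes it; this file moves no count.

THE MATHEMATICS (elementary).  (§1) Print's `|Ω(T,G)|` = ★ `Ch12Sec5.weylOrder T = Nat.card (N(T) ⧸ T)` IS the index `[N(T):T] = (T.subgroupOf N(T)).index` —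
definitionally (`Subgroup.index := Nat.card (· ⧸ ·)`); the (E0) sigsheet and the UP-TR letters spell the index, ★ `innerG`∕`innerH` spell `weylOrder`.  (§2) On a COMPACT
subgroup `T` (every member of the RUNG0 Cartan systems `Sell`, `SH` is compact: pins `hcartO`, `hKHO`), the compact core of `↥T` is everything (★ `compactCore_eq_univ`), so
«Haar measure with `compactCore`-mass one» (the (E0)∕(A1′) letter `htH`, the `G`-side pin `hcoreGO`) and «Haar probability measure» (the `H`-side pin `hprobHO`, print's
«meas(Z∖T) = 1» p. 182) are the SAME normalisation, and two such measures COINCIDE (Mathlib `Measure.isHaarMeasure_eq_of_isProbabilityMeasure`).  (§3) The docking forms: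
`∀ T ∈ SH, μTHf T = tH T`, `∀ T ∈ SH, μTHf T (compactCore ↥T) = 1` (so the pin measure itself may be fed as the letter `tH`), `∀ T′ ∈ Sell, IsProbabilityMeasure (μTf T′)`,
and uniqueness on `Sell`.
## References
* [Rogawski1990] J. D. Rogawski, *Automorphic Representations of Unitary Groups in Three Variables*, Ann. of Math. Stud. 123 (1990): §12.5 p. 182 (normalisation
  `meas(Z∖T) = 1` of the torus measures in the Weyl integration formula), p. 184 (`⟨ , ⟩_{G,e}`, `⟨ , ⟩_{H,e}`); §3.6 p. 29 (`Ω(T,G) = N(T)∕T`).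
* [BourbakiINT7] N. Bourbaki, *Intégration*, Ch. VII §1 no. 2 (uniqueness of Haar measure up to a scalar; on a compact group the normalised Haar measure is unique).
-/

set_option autoImplicit false
-- the mandated namespace has the single-problem summit's repeated segment (`HodgeConjecture.HodgeConjecture`)
set_option linter.dupNamespace false

noncomputable section

open MeasureTheory MeasureTheory.Measure Set
open Literature.NumberTheory.Automorphic Literature.NumberTheory.Rogawski1990

namespace Summit.HodgeConjecture.HodgeConjecture.Cruxes.H413.F0P3cStCharTSEllInnerMeasures

/-! ## §1 `|Ω(T,G)|` is the index `[N(T):T]` -/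

section Index

variable {G : Type*} [Group G]

/-- **`|Ω(T,G)| = [N_G(T) : T]`**: ★ `Ch12Sec5.weylOrder T` (print's `|Ω(T,G)|`, `Nat.card` of `N(T) ⧸ T`) is the index of `T` in its normaliser — by definition of
`Subgroup.index`. [cite: Rogawski1990, §3.6 p. 29] -/
theorem weylOrder_eq_index (T : Subgroup G) :
    Ch12Sec5.weylOrder T = (T.subgroupOf (Subgroup.normalizer (T : Set G))).index := rfl

/-- The same identity read on the complex weights `|Ω(T,G)|⁻¹` of ★ `innerG` ∕ `innerH`. [cite: Rogawski1990, §12.5 p. 184] -/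
theorem inv_weylOrder_cast_eq_inv_index_cast (T : Subgroup G) :
    ((Ch12Sec5.weylOrder T : ℂ))⁻¹ = (((T.subgroupOf (Subgroup.normalizer (T : Set G))).index : ℂ))⁻¹ := by
  rw [weylOrder_eq_index]

end Index

/-! ## §2 Compact subgroups: `compactCore`-mass one = probability, and uniqueness of the normalised Haar measure -/

section Compact

variable {X : Type*} [Group X] [TopologicalSpace X]

/-- On a compact subgroup `T`, the compact core of `↥T` is all of `↥T` (★ `compactCore_eq_univ` for the compact space `↥T`). [cite: Rogawski1990, §12.5 p. 182] -/
theorem compactCore_eq_univ_of_isCompact (T : Subgroup X) (hT : IsCompact (T : Set X)) :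
    compactCore ↥T = (univ : Set ↥T) := by
  haveI : CompactSpace ↥T := isCompact_iff_compactSpace.mp hT
  exact compactCore_eq_univ _

variable [MeasurableSpace X]

/-- On a compact subgroup, a measure with `compactCore`-mass one (the letter `htH`, the pin `hcoreGO`) is a probability measure. [cite: Rogawski1990, §12.5 p. 182] -/
theorem isProbabilityMeasure_of_apply_compactCore_eq_one (T : Subgroup X) (hT : IsCompact (T : Set X))
    (t : Measure ↥T) (ht : t (compactCore ↥T) = 1) : IsProbabilityMeasure t :=
  ⟨by rwa [compactCore_eq_univ_of_isCompact T hT] at ht⟩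

/-- On a compact subgroup, a probability measure (the pin `hprobHO`) has `compactCore`-mass one (the letter `htH`). [cite: Rogawski1990, §12.5 p. 182] -/
theorem apply_compactCore_eq_one_of_isProbabilityMeasure (T : Subgroup X) (hT : IsCompact (T : Set X))
    (t : Measure ↥T) [IsProbabilityMeasure t] : t (compactCore ↥T) = 1 := by
  rw [compactCore_eq_univ_of_isCompact T hT, measure_univ]

variable [IsTopologicalGroup X] [BorelSpace X]

/-- **Uniqueness of the normalised Haar measure on a compact subgroup**: two Haar measures on `↥T` with `compactCore`-mass one coincide (Mathlib
`Measure.isHaarMeasure_eq_of_isProbabilityMeasure`). [cite: Rogawski1990, §12.5 p. 182] [cite: BourbakiINT7, Ch. VII §1 no. 2] -/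
theorem eq_of_isHaarMeasure_of_apply_compactCore_eq_one (T : Subgroup X) (hT : IsCompact (T : Set X))
    (t t' : Measure ↥T) [t.IsHaarMeasure] [t'.IsHaarMeasure]
    (ht : t (compactCore ↥T) = 1) (ht' : t' (compactCore ↥T) = 1) : t = t' := by
  haveI : CompactSpace ↥T := isCompact_iff_compactSpace.mp hT
  haveI := isProbabilityMeasure_of_apply_compactCore_eq_one T hT t ht
  haveI := isProbabilityMeasure_of_apply_compactCore_eq_one T hT t' ht'
  exact isHaarMeasure_eq_of_isProbabilityMeasure t t'

/-- The same with one side given as a probability measure (pin `hprobHO`) and the other by `compactCore`-mass one (letter `htH`).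
[cite: Rogawski1990, §12.5 p. 182] [cite: BourbakiINT7, Ch. VII §1 no. 2] -/
theorem eq_of_isHaarMeasure_of_isProbabilityMeasure_of_apply_compactCore_eq_one (T : Subgroup X) (hT : IsCompact (T : Set X))
    (t t' : Measure ↥T) [t.IsHaarMeasure] [IsProbabilityMeasure t] [t'.IsHaarMeasure]
    (ht' : t' (compactCore ↥T) = 1) : t = t' :=
  eq_of_isHaarMeasure_of_apply_compactCore_eq_one T hT t t' (apply_compactCore_eq_one_of_isProbabilityMeasure T hT t) ht'

end Compact

/-! ## §3 The docking forms: RUNG0 Cartan pins ↔ (E0)∕(A1′) letters -/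

section Dock

variable {X : Type*} [Group X] [TopologicalSpace X] [MeasurableSpace X]

/-- **`H`-side dock, letter form**: the pinned probability measures themselves satisfy the (E0)∕(A1′) letter `htH` — `μTHf T (compactCore ↥T) = 1` on `SH` — so the
pin family may be fed AS the letter `tH`. [cite: Rogawski1990, §12.5 p. 182] -/
theorem pinMeasure_apply_compactCore_eq_one (SH : Finset (Subgroup X)) (μTHf : (T : Subgroup X) → Measure ↥T)
    (hKH : ∀ T ∈ SH, IsCompact (T : Set X)) (hprobHO : ∀ T ∈ SH, IsProbabilityMeasure (μTHf T)) :
    ∀ T ∈ SH, μTHf T (compactCore ↥T) = 1 := by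
  intro T hT
  haveI := hprobHO T hT
  exact apply_compactCore_eq_one_of_isProbabilityMeasure T (hKH T hT) (μTHf T)

/-- **`G`-side dock**: on a system `Sell` of COMPACT Cartan subgroups (pin `hcartO`, first conjunct), the pinned Haar measures `μTf T′` normalised by
`μTf T′ (compactCore ↥T′) = 1` (pin `hcoreGO`) are probability measures (print's «meas(Z∖T) = 1», p. 182). [cite: Rogawski1990, §12.5 p. 182] -/
theorem isProbabilityMeasure_pin_of_compact (Sell : Finset (Subgroup X)) (μTf : (T' : Subgroup X) → Measure ↥T')
    (hcart : ∀ T' ∈ Sell, IsCompact (T' : Set X)) (hcoreGO : ∀ T' ∈ Sell, μTf T' (compactCore ↥T') = 1) :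
    ∀ T' ∈ Sell, IsProbabilityMeasure (μTf T') :=
  fun T' hT' => isProbabilityMeasure_of_apply_compactCore_eq_one T' (hcart T' hT') (μTf T') (hcoreGO T' hT')

variable [IsTopologicalGroup X] [BorelSpace X]

/-- **`H`-side dock**: on a system `SH` of COMPACT Cartan subgroups (pin `hKHO`), the pinned Haar probability measures `μTHf T` (pins `hHaarHO`, `hprobHO`) and any
Haar letter `tH T` normalised by `tH T (compactCore ↥T) = 1` (letter `htH`) COINCIDE member by member. [cite: Rogawski1990, §12.5 pp. 182, 184] -/
theorem pinMeasure_eq_letter_of_compact (SH : Finset (Subgroup X)) (μTHf tH : (T : Subgroup X) → Measure ↥T)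
    (hKH : ∀ T ∈ SH, IsCompact (T : Set X))
    (hHaarHO : ∀ T ∈ SH, (μTHf T).IsHaarMeasure) (hprobHO : ∀ T ∈ SH, IsProbabilityMeasure (μTHf T))
    (htHaar : ∀ T ∈ SH, (tH T).IsHaarMeasure) (htH : ∀ T ∈ SH, tH T (compactCore ↥T) = 1) :
    ∀ T ∈ SH, μTHf T = tH T := by
  intro T hT
  haveI := hHaarHO T hT
  haveI := hprobHO T hT
  haveI := htHaar T hT
  exact eq_of_isHaarMeasure_of_isProbabilityMeasure_of_apply_compactCore_eq_one T (hKH T hT) (μTHf T) (tH T) (htH T hT)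

/-- **`G`-side uniqueness**: any other Haar family on `Sell` with `compactCore`-mass one equals the pinned one member by member. [cite: Rogawski1990, §12.5 p. 182]
[cite: BourbakiINT7, Ch. VII §1 no. 2] -/
theorem pinMeasure_eq_of_compact_of_apply_compactCore_eq_one (Sell : Finset (Subgroup X)) (μTf t : (T' : Subgroup X) → Measure ↥T')
    (hcart : ∀ T' ∈ Sell, IsCompact (T' : Set X))
    (hHaarGO : ∀ T' ∈ Sell, (μTf T').IsHaarMeasure) (hcoreGO : ∀ T' ∈ Sell, μTf T' (compactCore ↥T') = 1)
    (htHaar : ∀ T' ∈ Sell, (t T').IsHaarMeasure) (ht : ∀ T' ∈ Sell, t T' (compactCore ↥T') = 1) :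
    ∀ T' ∈ Sell, μTf T' = t T' := by
  intro T' hT'
  haveI := hHaarGO T' hT'
  haveI := htHaar T' hT'
  exact eq_of_isHaarMeasure_of_apply_compactCore_eq_one T' (hcart T' hT') (μTf T') (t T') (hcoreGO T' hT') (ht T' hT')

end Dock

end Summit.HodgeConjecture.HodgeConjecture.Cruxes.H413.F0P3cStCharTSEllInnerMeasures

end
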